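import Summits.AtomisticToContinuum.BoseEinsteinCondensation.Theses.BECTangentRigidity
import Literature.MathematicalPhysics.QuantumManyBody.BoseGasThermodynamicLimitRuelle

/-!
# Birth skeleton (BC3) for the crux `RigidMomentumBound` of route `BECTangentRigidity`

Crux item `stmt-AtomisticToContinuum-13034`; registrar seat
`planner-skel-stmt-AtomisticToContinuum-13034-0` (2026-08-17). Published as
`Cruxes/RigidMomentumBound/Lines/birth.lean`.

**The crux** (`Summit.AtomisticToContinuum.BoseEinsteinCondensation.Theses.BECTangentRigidity.RigidMomentumBound`):
for every repulsive finite-range `v`, at all small `ρ`, for every `ε > 0`, eventually in `N` there is `δ > 0`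
such that every `δ`-near-minimiser `Ψ` of the Dirichlet energy in the box of side `L = L_N = (N/ρ)^{1/3}` has
total-momentum fluctuation `⟨P_tot²⟩_Ψ = ∑_a ∫ |∑_j ∂_{j,a}Ψ|² ≤ ε N²/L²` (the ground state is not a
Galilean cat). Here `fderiv ℝ Ψ.ψ X (fun _ ↦ e_a) = ∑_j ∂_{j,a}Ψ(X)` is the derivative along the rigid
translation of all particles in direction `a`.

**The line (canonical one-body / two-body split).** Expanding the square,
`⟨P_tot²⟩ = ∑_j ⟨p_j²⟩ + ∑_{j≠k} ⟨p_j·p_k⟩ = T(Ψ) + N(N-1)⟨p₁·p₂⟩` (Bose symmetry), where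
`T(Ψ) = ∫ kineticDensity Ψ.ψ` is the kinetic energy.

* **S1 `stub_dirichletEnergyLinear`** (one-body input; provable now, size S/M): at fixed small density the
  Dirichlet ground-state energy is `O(N)`: `E₀^D(N, L_N) ≤ C·N` eventually in `N`. This is LSSY 2005 Thm 2.2 /
  (2.14) in its crudest form; in the tree it follows from
  `BoseGas.limsup_lt_top_of_small` (or `criticalDensity_pos` +
  `tendsto_energyPerParticleDirichlet_of_lt_criticalDensity`, file `BoseGasThermodynamicLimitRuelle`): the
  upper energy per particle `e⁺(ρ) = limsup E₀^D(N,L_N)/N` is finite for `ρ(1+R)³ < 1`, hence eventually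
  `E₀^D(N,L_N) ≤ (e⁺(ρ)+1)·N`. With the variational step `T(Ψ) ≤ energy v Ψ ≤ E₀ + δ` (done in the assembly)
  it makes the ONE-BODY part negligible: `O(N) = o(N²/L²)` because `N = ρ L_N³`, `N²/L_N² = ρ² L_N⁴`, `L_N → ∞`.
* **S2 `stub_pairMomentumDecorrelation`** (two-body input; the load-bearing stub, open): for near-minimisers
  the TWO-BODY part is `o(N²/L²)`: `⟨P_tot²⟩_Ψ ≤ T(Ψ) + ε N²/L²`, i.e. `∑_{j≠k}⟨p_j·p_k⟩ = N(N-1)⟨p₁·p₂⟩ ≤ ε N²/L²`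
  — no macroscopic pair-momentum (superflow) correlation in the Dirichlet ground state. Its negation
  `⟨p₁·p₂⟩ ≥ ε/L²` is verbatim the refutation scenario in the crux's why-might-fail; physically the pair term is
  NEGATIVE of order `N` for the GP/Bogoliubov state (it cancels the bulk of `T ≈ 4πaρN` down to the wall value
  `2√2 N/(Lξ)`), and equals `+4π²𝔼|n|² N²/L²` for the Fejér cat. Stated junk-free in `ℝ≥0∞` (no signed cross
  integral): for `C¹` compactly supported `Ψ` the two sides differ exactly by `∑_{j≠k} Re⟨∂_{j,a}Ψ, ∂_{k,a}Ψ⟩`.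
* **Assembly `RigidMomentumBound_of`** (kernel-checked, no `sorry` of its own): `ρ₀ := min`, S2 at `ε/2`,
  `δ := min δ₂ 1`, `T ≤ E₀ + δ ≤ C N + 1`, and the thermodynamic scaling `C N + 1 ≤ (ε/2) N²/L_N²` once
  `L_N ≥ 2(C+1)/(ερ)` (`tendsto_sideLength_atTop`, `sideLength_pow_three`); then `ε/2 + ε/2`.

Disproof used: none — no `Disproof.lean` / Negative lemma exists for this crux yet (no `Cruxes/RigidMomentumBound`
directory before this file); dead lines: none recorded. Neither stub is an instance of a refuted statement
(`ledger negatives`: the BEC entries concern other functionals).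
-/

noncomputable section

namespace Summit.AtomisticToContinuum.BoseEinsteinCondensation.Cruxes.RigidMomentumBound.Birth

open MeasureTheory Filter
open scoped ENNReal NNReal BigOperators
open Literature.MathematicalPhysics.QuantumManyBody.BoseGas
open Summit.AtomisticToContinuum.BoseEinsteinCondensation.Theses.BECTangentRigidity

/-! ## S1 — the one-body input: the Dirichlet energy at fixed small density is `O(N)` -/

/-- **S1 `stub_dirichletEnergyLinear`.** For every repulsive finite-range `v` there is `ρ₀ > 0` such that
for every density `0 < ρ < ρ₀` there is a constant `C ≥ 0` with `E₀^D(N, (N/ρ)^{1/3}) ≤ C·N` for all large `N`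
(linear upper bound on the Dirichlet ground-state energy along the fixed-density box sequence). Why true:
LSSY 2005 Thm 2.2 (`e₀(ρ) ≤ 4πρa(1 + C Y^{1/3})`, any b.c.); in the tree, for `ρ(1+R)³ < 1` (one particle per
unit cell, `R` a range of `v`, hard cores allowed) `limsup_N E₀^D(N,L_N)/N < ⊤`
(`BoseGas.limsup_lt_top_of_small`), and a finite limsup in `ℝ≥0∞` bounds the sequence eventually by
`limsup + 1`. Size: S/M. Sources: LSSY2005 Thm 2.2; Ruelle1969 §3.5.11; tree
`Literature/MathematicalPhysics/QuantumManyBody/BoseGasThermodynamicLimitRuelle.lean`. -/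
theorem stub_dirichletEnergyLinear :
    ∀ v : ℝ → ℝ≥0∞, IsRepulsiveFiniteRange v → ∃ ρ₀ : ℝ, 0 < ρ₀ ∧ ∀ ρ : ℝ, 0 < ρ → ρ < ρ₀ →
      ∃ C : ℝ, 0 ≤ C ∧ ∀ᶠ N : ℕ in atTop,
        groundStateEnergy v N (sideLength ρ N) ≤ ENNReal.ofReal (C * N) := by
  sorry

/-! ## S2 — the two-body input: no macroscopic pair-momentum correlation -/

/-- **S2 `stub_pairMomentumDecorrelation` (load-bearing).** For every repulsive finite-range `v`, at all small
`ρ`, for every `ε > 0`, eventually in `N` there is `δ > 0` such that every `δ`-near-minimiser `Ψ` of the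
Dirichlet energy in the box of side `L = (N/ρ)^{1/3}` satisfies
`∑_a ∫ |∑_j ∂_{j,a}Ψ|² ≤ ∫ kineticDensity Ψ + ε N²/L²`, i.e. the total-momentum fluctuation exceeds its
one-body (diagonal) part `T(Ψ) = ∑_j⟨p_j²⟩` by at most `ε N²/L²`; equivalently (expand the square; Bose
symmetry) the pair-momentum correlation obeys `∑_{j≠k}⟨p_j·p_k⟩_Ψ = N(N-1)⟨p₁·p₂⟩_Ψ ≤ ε N²/L²`. Why it might
be true: for the GP/Bogoliubov description of the Dirichlet ground state the pair term is negative (`≈ -T +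
2√2N/(Lξ)`); it is the statement that the ground state carries no superposition of macroscopic uniform flows
(Fejér cats have pair term `+4π²𝔼|n|²N²/L²`). Why it might fail: exactly the crux's clause "`⟨p₁·p₂⟩ ≥ ε/L²`
refutes it" — an exact-ground-state property at the kinetic-gap scale with no energetic proof. Size: the
crux's open core (XL). Sources: LSSY2005 §5.2 fn. 2; doi:10.1103/physreva.7.2187; arXiv:0910.2805. -/
theorem stub_pairMomentumDecorrelation :
    ∀ v : ℝ → ℝ≥0∞, IsRepulsiveFiniteRange v → ∃ ρ₀ : ℝ, 0 < ρ₀ ∧ ∀ ρ : ℝ, 0 < ρ → ρ < ρ₀ →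
      ∀ ε : ℝ, 0 < ε → ∀ᶠ N : ℕ in atTop, ∃ δ : ℝ≥0∞, 0 < δ ∧
        ∀ Ψ : TrialState N (sideLength ρ N),
          energy v Ψ ≤ groundStateEnergy v N (sideLength ρ N) + δ →
            ∑ a : Fin 3, ∫⁻ X, (‖fderiv ℝ Ψ.ψ X (fun _ : Fin N => EuclideanSpace.single a (1 : ℝ))‖₊ : ℝ≥0∞) ^ 2
              ≤ (∫⁻ X, kineticDensity Ψ.ψ X) + ENNReal.ofReal (ε * (N : ℝ) ^ 2 / sideLength ρ N ^ 2) := by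
  sorry

/-! ## Assembly — the crux from S1 + S2 (sorry-free) -/

/-- Thermodynamic scaling: a linear quantity is `o(N²/L_N²)` — for real `C`, `ε > 0`, `ρ > 0`, eventually in
`N`, `C·N + 1 ≤ (ε/2)·N²/L_N²` (because `N = ρ L_N³ ≥ 1`, so `N²/L_N² = ρ² L_N⁴`, and `L_N → ∞`). -/
theorem eventually_linear_le_sq_div_sideLength_sq (C : ℝ) {ε ρ : ℝ} (hε : 0 < ε) (hρ : 0 < ρ) :
    ∀ᶠ N : ℕ in atTop, C * N + 1 ≤ ε / 2 * (N : ℝ) ^ 2 / sideLength ρ N ^ 2 := by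
  filter_upwards [(tendsto_sideLength_atTop hρ).eventually_ge_atTop (2 * (C + 1) / (ε * ρ)),
    eventually_ge_atTop 1] with N hL hN1
  have hN0 : 0 < N := hN1
  have hLpos : 0 < sideLength ρ N := Real.rpow_pos_of_pos (div_pos (Nat.cast_pos.2 hN0) hρ) _
  have hρ0 : ρ ≠ 0 := hρ.ne'
  have hNρ : (N : ℝ) = ρ * sideLength ρ N ^ 3 := by
    rw [sideLength_pow_three hρ N]
    field_simp
  have hone : (1 : ℝ) ≤ ρ * sideLength ρ N ^ 3 := by
    rw [← hNρ]
    exact_mod_cast hN1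
  have hCL : C + 1 ≤ ε / 2 * ρ * sideLength ρ N := by
    have h' := (div_le_iff₀ (by positivity : (0 : ℝ) < ε * ρ)).1 hL
    nlinarith [h']
  rw [le_div_iff₀ (by positivity : (0 : ℝ) < sideLength ρ N ^ 2), hNρ]
  calc (C * (ρ * sideLength ρ N ^ 3) + 1) * sideLength ρ N ^ 2
        ≤ ((C + 1) * (ρ * sideLength ρ N ^ 3)) * sideLength ρ N ^ 2 := by
          apply mul_le_mul_of_nonneg_right _ (by positivity)
          nlinarith [hone]
    _ = (C + 1) * (ρ * sideLength ρ N ^ 5) := by ring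
    _ ≤ (ε / 2 * ρ * sideLength ρ N) * (ρ * sideLength ρ N ^ 5) :=
          mul_le_mul_of_nonneg_right hCL (by positivity)
    _ = ε / 2 * (ρ * sideLength ρ N ^ 3) ^ 2 := by ring

/-- **`RigidMomentumBound` from the line** (kernel-checked; the only `sorry`s are inside the two stubs).
For admissible `v`: take `ρ₀ := min ρ₁ ρ₂` of the stubs' density thresholds; at `0 < ρ < ρ₀` and `ε > 0`,
S1 gives `C` with `E₀^D(N,L_N) ≤ C N` eventually, S2 at `ε/2` gives `δ₂` eventually, and the scaling lemma
gives `C N + 1 ≤ (ε/2)N²/L_N²` eventually; on the intersection put `δ := min δ₂ 1`: a `δ`-near-minimiser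
`Ψ` has `T(Ψ) ≤ energy ≤ E₀ + δ ≤ C N + 1 ≤ (ε/2) N²/L²` (variational principle: the kinetic density is
part of the energy density) and, by S2, `⟨P_tot²⟩ ≤ T + (ε/2)N²/L² ≤ ε N²/L²`. -/
theorem RigidMomentumBound_of : RigidMomentumBound := by
  intro v hv
  obtain ⟨ρ₁, hρ₁, h₁⟩ := stub_dirichletEnergyLinear v hv
  obtain ⟨ρ₂, hρ₂, h₂⟩ := stub_pairMomentumDecorrelation v hv
  refine ⟨min ρ₁ ρ₂, lt_min hρ₁ hρ₂, fun ρ hρ hρlt ε hε => ?_⟩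
  obtain ⟨C, hC, hE₀⟩ := h₁ ρ hρ (hρlt.trans_le (min_le_left _ _))
  have hB := h₂ ρ hρ (hρlt.trans_le (min_le_right _ _)) (ε / 2) (half_pos hε)
  filter_upwards [hE₀, hB, eventually_linear_le_sq_div_sideLength_sq C hε hρ] with N hN₁ hN₂ hN₃
  obtain ⟨δ₂, hδ₂, hB'⟩ := hN₂
  refine ⟨min δ₂ 1, lt_min hδ₂ one_pos, fun Ψ hΨ => ?_⟩
  have hΨ₂ : energy v Ψ ≤ groundStateEnergy v N (sideLength ρ N) + δ₂ :=
    hΨ.trans (add_le_add le_rfl (min_le_left _ _))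
  -- the one-body part: kinetic energy ≤ energy ≤ E₀ + δ ≤ C N + 1 ≤ (ε/2) N²/L²
  have hT : ∫⁻ X, kineticDensity Ψ.ψ X ≤ ENNReal.ofReal (ε / 2 * (N : ℝ) ^ 2 / sideLength ρ N ^ 2) :=
    calc ∫⁻ X, kineticDensity Ψ.ψ X ≤ energy v Ψ := lintegral_mono fun X => le_self_add
      _ ≤ groundStateEnergy v N (sideLength ρ N) + min δ₂ 1 := hΨ
      _ ≤ ENNReal.ofReal (C * N) + 1 := add_le_add hN₁ (min_le_right _ _)
      _ = ENNReal.ofReal (C * N + 1) := by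
          rw [ENNReal.ofReal_add (by positivity) zero_le_one, ENNReal.ofReal_one]
      _ ≤ ENNReal.ofReal (ε / 2 * (N : ℝ) ^ 2 / sideLength ρ N ^ 2) := ENNReal.ofReal_le_ofReal hN₃
  -- the two-body part (S2) and the sum ε/2 + ε/2
  calc ∑ a : Fin 3, ∫⁻ X,
          (‖fderiv ℝ Ψ.ψ X (fun _ : Fin N => EuclideanSpace.single a (1 : ℝ))‖₊ : ℝ≥0∞) ^ 2
        ≤ (∫⁻ X, kineticDensity Ψ.ψ X) + ENNReal.ofReal (ε / 2 * (N : ℝ) ^ 2 / sideLength ρ N ^ 2) :=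
          hB' Ψ hΨ₂
    _ ≤ ENNReal.ofReal (ε / 2 * (N : ℝ) ^ 2 / sideLength ρ N ^ 2) +
          ENNReal.ofReal (ε / 2 * (N : ℝ) ^ 2 / sideLength ρ N ^ 2) := add_le_add hT le_rfl
    _ = ENNReal.ofReal (ε * (N : ℝ) ^ 2 / sideLength ρ N ^ 2) := by
          rw [← ENNReal.ofReal_add (by positivity) (by positivity)]
          congr 1
          ring

end Summit.AtomisticToContinuum.BoseEinsteinCondensation.Cruxes.RigidMomentumBound.Birth

end
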